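/-
Origin: expansion seat `planner-pub-hodgecm-pv10-0`, handover #17 2026-08-18T04:49:57Z (`HOME/pub-hodgecm-pv10/lean/Pv10/IdeleTopology.lean`, md5 30d4ca90, 112 lines);
landed by the gen-6 packager in gate run 22 as `HodgeCM/PerL34/IdeleTopology.lean` (import ^import Pv[0-9]+\.→import HodgeCM.PerL34. ×1).
-/
/-
# Hausdorffness and local compactness of `C_K`: exactly what is needed and what is in print

WIP module `Pv10.IdeleTopology` (pub-hodgecm-pv10); intended landing
`HodgeCM/PerL34/IdeleTopology.lean`.

The properness criterion `isProperMap_of_comp_factor` (`ProperCriterion.lean`) is applied in N15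
(PerL v5 tex ll. 310–311) with target `C := C_L`, and asks for `[T2Space C_L] [CompactlyCoherentSpace C_L]`.
This file pins down, in the kernel, what those two instances amount to for Mathlib's idele class group
`IdeleClassGroup K = 𝔸_Kˣ ⧸ K^×`:

* `t2Space_ideleClassGroup_iff` : `C_K` is Hausdorff **iff** the principal ideles are closed in `𝔸_Kˣ`
  — the typed PRINT target `PrincipalIdelesClosed K` ("`K^*` is a discrete, and therefore closed,
  subgroup of `I_K`": Neukirch, *Algebraic Number Theory*, VI (1.5) Proposition, PDF p. 322
  [corpus:book:bynd-algebraic-number-theory p.322]; Cassels–Fröhlich, Ch. II §16 LEMMA "k^× is a discrete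
  subgroup of J_k", PDF p. 119 [corpus:book:editornd-algebraic-number-theory p.119]);
* `locallyCompactSpace_ideleClassGroup` : `C_K` is locally compact as soon as the finite adele ring is
  — the typed INFRASTRUCTURE target `FiniteAdeleRingLocallyCompact K` (Cassels–Fröhlich Ch. II §13 Lemma
  + §14 "V_k is locally compact because the k_v are locally compact and the o_v are compact", PDF p. 114
  [corpus:book:editornd-algebraic-number-theory p.114]; absent from the Mathlib pin, which has local
  compactness of `K_∞` and of each `K_v`, `v ∤ ∞`, but not compactness of `𝒪_v` for number fields);
* `compactlyCoherentSpace_ideleClassGroup` : both together give the `CompactlyCoherentSpace` instance.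

Mathlib supplies the generic steps (`Units` of a locally compact `T1` monoid are locally compact;
quotients of locally compact groups are locally compact; `G ⧸ N` is `T3` for closed `N`).
No PerL/QW8/2001 statement is used.
-/
import Summits.HodgeConjecture.HodgeCM.PerL34.IdeleClassGroup
import Mathlib.Topology.Maps.Proper.CompactlyGenerated

set_option autoImplicit false

noncomputable section

open Topology Set

namespace NumberField

open IsDedekindDomain
open scoped RestrictedProduct

variable (K : Type*) [Field K] [NumberField K]

/-! ## Hausdorffness -/

/-- (Ported verbatim from the HodgeCMPerL package; no docstring in the source.) -/
instance t2Space_infiniteAdeleRing : T2Space (InfiniteAdeleRing K) :=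
  inferInstanceAs (T2Space ((v : InfinitePlace K) → v.Completion))

/-- (Ported verbatim from the HodgeCMPerL package; no docstring in the source.) -/
instance t2Space_finiteAdeleRing : T2Space (FiniteAdeleRing (𝓞 K) K) :=
  inferInstanceAs (T2Space
    (Πʳ v : HeightOneSpectrum (𝓞 K), [v.adicCompletion K, v.adicCompletionIntegers K]))

/-- (Ported verbatim from the HodgeCMPerL package; no docstring in the source.) -/
instance t2Space_adeleRing : T2Space (AdeleRing (𝓞 K) K) :=
  inferInstanceAs (T2Space (InfiniteAdeleRing K × FiniteAdeleRing (𝓞 K) K))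

/-- The idele group `𝔸_Kˣ` is Hausdorff (kernel, from Mathlib). -/
instance t2Space_ideleGroup : T2Space (ideleGroup K) := inferInstance

/-- PRINT target: the principal ideles `K^× ⊂ 𝔸_Kˣ` form a closed subgroup (Neukirch VI (1.5),
PDF p. 322; Cassels–Fröhlich II §16 Lemma, PDF p. 119 — both prove the stronger discreteness). -/
def PrincipalIdelesClosed : Prop := IsClosed (principalIdeles K : Set (ideleGroup K))

/-- (Ported verbatim from the HodgeCMPerL package; no docstring in the source.) -/
theorem t2Space_ideleClassGroup (h : PrincipalIdelesClosed K) : T2Space (IdeleClassGroup K) := by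
  haveI : IsClosed (principalIdeles K : Set (ideleGroup K)) := h
  infer_instance

/-- (Ported verbatim from the HodgeCMPerL package; no docstring in the source.) -/
theorem principalIdelesClosed_of_t2Space [T2Space (IdeleClassGroup K)] : PrincipalIdelesClosed K := by
  have : (principalIdeles K : Set (ideleGroup K)) =
      (QuotientGroup.mk : ideleGroup K → IdeleClassGroup K) ⁻¹' {1} := by
    ext x
    simp only [SetLike.mem_coe, Set.mem_preimage, Set.mem_singleton_iff, QuotientGroup.eq_one_iff]
  rw [PrincipalIdelesClosed, this]
  exact (isClosed_singleton (X := IdeleClassGroup K) (x := 1)).preimage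
    (QuotientGroup.continuous_mk (N := principalIdeles K))

/-- `C_K` is Hausdorff iff `K^×` is closed in `𝔸_Kˣ`. -/
theorem t2Space_ideleClassGroup_iff : T2Space (IdeleClassGroup K) ↔ PrincipalIdelesClosed K :=
  ⟨fun _ => principalIdelesClosed_of_t2Space K, t2Space_ideleClassGroup K⟩

/-! ## Local compactness -/

/-- INFRASTRUCTURE target (absent from the Mathlib pin): the finite adele ring of a number field is
locally compact (Cassels–Fröhlich II §13 Lemma / §14, PDF p. 114: the `K_v` are locally compact and the
`𝒪_v` compact). -/
def FiniteAdeleRingLocallyCompact : Prop := LocallyCompactSpace (FiniteAdeleRing (𝓞 K) K)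

/-- (Ported verbatim from the HodgeCMPerL package; no docstring in the source.) -/
theorem locallyCompactSpace_adeleRing (h : FiniteAdeleRingLocallyCompact K) :
    LocallyCompactSpace (AdeleRing (𝓞 K) K) := by
  haveI : LocallyCompactSpace (FiniteAdeleRing (𝓞 K) K) := h
  exact inferInstanceAs (LocallyCompactSpace (InfiniteAdeleRing K × FiniteAdeleRing (𝓞 K) K))

/-- `𝔸_Kˣ` is locally compact (given local compactness of the finite adeles). -/
theorem locallyCompactSpace_ideleGroup (h : FiniteAdeleRingLocallyCompact K) :
    LocallyCompactSpace (ideleGroup K) := by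
  haveI := locallyCompactSpace_adeleRing K h
  infer_instance

/-- `C_K` is locally compact (given local compactness of the finite adeles). -/
theorem locallyCompactSpace_ideleClassGroup (h : FiniteAdeleRingLocallyCompact K) :
    LocallyCompactSpace (IdeleClassGroup K) := by
  haveI := locallyCompactSpace_ideleGroup K h
  infer_instance

/-- The two instances `isProperMap_of_comp_factor` asks of `C := C_K`. -/
theorem compactlyCoherentSpace_ideleClassGroup (h : FiniteAdeleRingLocallyCompact K) :
    CompactlyCoherentSpace (IdeleClassGroup K) := by
  haveI := locallyCompactSpace_ideleClassGroup K h
  infer_instance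

end NumberField

end
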